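import Mathlib
import Summits.ResolutionOfSingularities.ResolutionOfSingularities.Theses.WeightedInvariant
import Literature.AlgebraicGeometry.Resolution.CobordantChartCoefficients
import Literature.AlgebraicGeometry.Resolution.CobordantGame
import Summits.ResolutionOfSingularities.ResolutionOfSingularities.Theorems.WeightedInvariantGlobalizeLocalDropCanonize
import Summits.ResolutionOfSingularities.ResolutionOfSingularities.Theorems.WeightedInvariantGlobalizeLocalDropCylinder
import Summits.ResolutionOfSingularities.ResolutionOfSingularities.Theorems.WeightedInvariantGlobalizeLocalDropRegularGerms
import Summits.ResolutionOfSingularities.ResolutionOfSingularities.Theorems.WeightedInvariantLocalWeightedDropUnitRoot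
import Summits.ResolutionOfSingularities.ResolutionOfSingularities.Theorems.WeightedInvariantLocalWeightedDropSliceCyl
import Summits.ResolutionOfSingularities.ResolutionOfSingularities.Theorems.WeightedInvariantLocalWeightedDropTameSliceKappa

/-!
# `LocalWeightedDrop`, line `vertex-descent-weight-residues`: the tame slice, and the hardest stub is
# implied by the crux

Route `ResolutionOfSingularities/WeightedInvariant`, crux `LocalWeightedDrop` (stmt-ResolutionOfSingularities-8899),
line `vertex-descent-weight-residues` (first lead).  Two sorry-free results of the line, landed as support:

* `tameSlice` — the planner's TAME SLICE stub in its filed form (Luna's étale slice on Włodarczyk's `B₊`): in the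
  factorisation `F(s^w(c+y)) = sᵃ·g` at an exceptional point `c` (convention `cᵢ = 0` for `wᵢ = 0`), for every index
  `i` with `cᵢ ≠ 0` and `p ∤ wᵢ` the successor `g` is a unit times a formal coordinate change of the CYLINDER over its
  `n`-variable flat slice `g|_{yᵢ = 0}`.  Assembled from the landed stubs `stub_unitRoot` (`wᵢ`-th root of
  `1 + yᵢ/cᵢ`, using `(wᵢ : k) ≠ 0 ⇔ p ∤ wᵢ`), `stub_tameSliceKappa` (torus reparametrisation transport) and
  `stub_sliceCyl` (slice-then-cylinder = killing `yᵢ`).  Tightness: `p ∤ wᵢ` cannot be dropped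
  (`Theorems/LocalWeightedDrop/Negative/TameSliceFalseWithoutTame.lean`).
* `hornedRank_of_localWeightedDrop` — the CRUX IMPLIES the line's (reshaped) hardest stub `stub_hornedRank`: with
  `ρ :=` the least game value `CobordantGame.leastRank`, monotonicity under coordinate changes and units holds as
  equalities and under cylinders at won germs (`leastRank_subst`, `leastRank_unit_mul`, `leastRank_cyl_le`,
  `leastRank_cyl_fin_zero`, `won_of_allSingularWon` of the GlobalizeLocalDrop files, over `Literature…CobordantGame`),
  and the move clause holds through its second disjunct by the least value's own drop.  Since the line's skeleton
  (`Cruxes/LocalWeightedDrop/Lines/vertex-descent-weight-residues.lean`, `LocalWeightedDrop_of`) derives the crux from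
  that stub's statement alone, the hardest stub is EQUIVALENT to the crux: the line is a faithful equivariant
  reformulation of `LocalWeightedDrop` (tame points never grow the embedding dimension; wild points keep a
  `ℤ/D`-graded honest successor), not a reduction of it.
-/

set_option linter.dupNamespace false -- mandated namespace of this single-conjunct summit

namespace Summit.ResolutionOfSingularities.ResolutionOfSingularities.Theorems

open Literature.AlgebraicGeometry.Resolution
open Summit.ResolutionOfSingularities.ResolutionOfSingularities.Theses.WeightedInvariant

/-- TAME SLICE (Luna's étale slice on `B₊`, filed form of the planner's `stub_tameSlice`): at an exceptional point
with `cᵢ ≠ 0` and `p ∤ wᵢ` the `s`-saturated successor `g` is a unit times a formal coordinate change of the cylinder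
over its `n`-variable flat slice `g|_{yᵢ = 0}`. -/
theorem tameSlice : ∀ (p : ℕ), p.Prime → ∀ (k : Type) [Field k] [CharP k p] (n : ℕ) (F : MvPowerSeries (Fin n) k)
    (w : Fin n → ℕ) (c : Fin n → k), (∀ i, w i = 0 → c i = 0) → ∀ (a : ℕ) (g : MvPowerSeries (Fin (n + 1)) k),
    MvPowerSeries.subst (CobordantChart.chart w c) F = MvPowerSeries.X 0 ^ a * g → ∀ i : Fin n, c i ≠ 0 → ¬ (p ∣ w i) →
    ∃ (Φ : Fin (n + 1) → MvPowerSeries (Fin (n + 1)) k) (u : MvPowerSeries (Fin (n + 1)) k),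
      (∀ j, MvPowerSeries.constantCoeff (Φ j) = 0) ∧
      IsUnit (Matrix.det (Matrix.of fun j l => MvPowerSeries.coeff (Finsupp.single l 1) (Φ j))) ∧
      MvPowerSeries.constantCoeff u ≠ 0 ∧
      g = u * MvPowerSeries.subst Φ (MvPowerSeries.subst
        (fun m : Fin n => (MvPowerSeries.X ((Fin.succ i).succAbove m) : MvPowerSeries (Fin (n + 1)) k))
        (MvPowerSeries.subst (fun j : Fin (n + 1) => if j = i.succ then (0 : MvPowerSeries (Fin n) k)
          else MvPowerSeries.X (Fin.predAbove i j)) g)) := by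
  intro p _hp k _ _ n F w c hc a g hfac i hci hpw
  have hm : ((w i : ℕ) : k) ≠ 0 := by
    intro h
    exact hpw ((CharP.cast_eq_zero_iff k p (w i)).mp h)
  obtain ⟨r, hr1, hrw, hrsupp⟩ := stub_unitRoot k n i.succ (w i) hm (c i) hci
  obtain ⟨Φ, u, hΦ0, hΦdet, hu, hg⟩ := stub_tameSliceKappa k n F w c hc a g hfac i hci r hr1 hrw hrsupp
  refine ⟨Φ, u, hΦ0, hΦdet, hu, ?_⟩
  rw [stub_sliceCyl k n i g]
  exact hg

/-- THE CONVERSE (sorry-free): the crux implies the hardest stub's statement, with `ρ :=` the least game value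
`CobordantGame.leastRank`.  Its monotonicity under coordinate changes and units holds as unconditional EQUALITIES and
under cylinders at won germs (seat 14763's `Theorems.leastRank_subst`, `leastRank_unit_mul`, `leastRank_cyl_le`,
`leastRank_cyl_fin_zero`, `won_of_allSingularWon`, built on `Literature…CobordantGame`), and the move clause is met
through its second disjunct by the least value's own drop.  Together with the line's skeleton theorem
`LocalWeightedDrop_of` (which uses nothing about `stub_hornedRank` but its statement): the (reshaped) hardest stub is
EQUIVALENT to the crux. -/
theorem hornedRank_of_localWeightedDrop :
    Summit.ResolutionOfSingularities.ResolutionOfSingularities.Theses.WeightedInvariant.LocalWeightedDrop →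
    ∀ (p : ℕ), p.Prime → ∀ (k : Type) [Field k] [CharP k p] [IsAlgClosed k],
    ∃ ρ : (n : ℕ) → MvPowerSeries (Fin n) k → Ordinal.{0},
    (∀ (n : ℕ) (f : MvPowerSeries (Fin n) k) (Φ : Fin n → MvPowerSeries (Fin n) k),
      (∀ i, MvPowerSeries.constantCoeff (Φ i) = 0) →
      IsUnit (Matrix.det (Matrix.of fun i j => MvPowerSeries.coeff (Finsupp.single j 1) (Φ i))) →
      ρ n (MvPowerSeries.subst Φ f) ≤ ρ n f) ∧
    (∀ (n : ℕ) (f u : MvPowerSeries (Fin n) k), MvPowerSeries.constantCoeff u ≠ 0 → ρ n (u * f) ≤ ρ n f) ∧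
    (∀ (n : ℕ) (j : Fin (n + 1)) (h : MvPowerSeries (Fin n) k),
      ρ (n + 1) (MvPowerSeries.subst (fun m : Fin n => (MvPowerSeries.X (j.succAbove m) : MvPowerSeries (Fin (n + 1)) k)) h)
        ≤ ρ n h) ∧
    ∀ (n : ℕ) (f : MvPowerSeries (Fin n) k),
      (f ≠ 0 ∧ MvPowerSeries.constantCoeff f = 0 ∧ ∀ i, MvPowerSeries.coeff (Finsupp.single i 1) f = 0) →
      ∃ (θ : Fin n → MvPowerSeries (Fin n) k) (w : Fin n → ℕ),
        (∀ i, MvPowerSeries.constantCoeff (θ i) = 0) ∧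
        IsUnit (Matrix.det (Matrix.of fun i j => MvPowerSeries.coeff (Finsupp.single j 1) (θ i))) ∧
        (∃ i, 0 < w i) ∧
        ∀ (c : Fin n → k), (∀ i, w i = 0 → c i = 0) → c ≠ 0 →
        ∀ (a : ℕ) (g : MvPowerSeries (Fin (n + 1)) k),
          MvPowerSeries.subst (CobordantChart.chart w c) (MvPowerSeries.subst θ f) = MvPowerSeries.X 0 ^ a * g →
          ¬ (MvPowerSeries.X (0 : Fin (n + 1)) ∣ g) →
          (MvPowerSeries.constantCoeff g = 0 ∧ ∀ j, MvPowerSeries.coeff (Finsupp.single j 1) g = 0) →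
          (∀ D : ℕ, (∀ i, c i ≠ 0 → D ∣ w i) → ∀ e : Fin (n + 1) →₀ ℕ, MvPowerSeries.coeff e g ≠ 0 →
            Finsupp.weight w (Finsupp.tail e) ≡ a + e 0 [MOD D]) →
          ((∃ i : Fin n, c i ≠ 0 ∧ ¬ (p ∣ w i) ∧
              ρ n (MvPowerSeries.subst (fun j : Fin (n + 1) => if j = i.succ then (0 : MvPowerSeries (Fin n) k)
                else MvPowerSeries.X (Fin.predAbove i j)) g) < ρ n f) ∨
            ρ (n + 1) g < ρ n f) := by
  classical
  intro h p hp k _ _ _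
  have hall : ∀ (n : ℕ) (f : MvPowerSeries (Fin n) k), CobordantGame.IsSingular k f → CobordantGame.Won k n f :=
    (localWeightedDrop_iff_allWon.mp h) p hp k
  refine ⟨CobordantGame.leastRank, ?_, ?_, ?_, ?_⟩
  · -- (H1) coordinate changes: an equality
    intro n f Φ hΦ0 hdet
    exact (leastRank_subst hΦ0 hdet f).le
  · -- (H2) units: an equality
    intro n f u hu
    exact (leastRank_unit_mul hu f).le
  · -- (H3) cylinders
    intro n j hh
    rcases Nat.eq_zero_or_pos n with rfl | hn
    · rw [leastRank_cyl_fin_zero]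
      exact bot_le
    · exact leastRank_cyl_le j
        (won_of_allSingularWon hall hn hh)
  · -- (H4') the move clause, through its second disjunct
    intro n f hf
    have hW := CobordantGame.wonBy_leastRank (hall n f hf)
    rw [CobordantGame.wonBy_iff] at hW
    obtain ⟨θ, w, ⟨hθ0, hdet, hwpos⟩, hs⟩ := hW
    refine ⟨θ, w, hθ0, hdet, hwpos, ?_⟩
    intro c hconv hcne a g hfac hndvd hsing _hgrad
    right
    have hsucc : CobordantGame.IsSuccessor k f θ w g := by
      refine ⟨c, a, ?_, ?_, hndvd, hsing⟩
      · have : ∃ i, c i ≠ 0 := by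
          by_contra hh
          push Not at hh
          exact hcne (funext hh)
        obtain ⟨i, hi⟩ := this
        exact ⟨i, Nat.pos_of_ne_zero (fun h0 => hi (hconv i h0)), hi⟩
      · have hc' : (fun i => if 0 < w i then c i else 0) = c := by
          funext i
          by_cases hwi : 0 < w i
          · rw [if_pos hwi]
          · rw [if_neg hwi, hconv i (Nat.eq_zero_of_not_pos hwi)]
        have hchart : CobordantGame.cruxChart k w c = CobordantChart.chart w c := by
          have := CobordantChart.cruxChart_eq_chart (k := k) w c
          rw [hc'] at this
          exact this
        rw [hchart]
        exact hfac
    obtain ⟨β, hβ, hWg⟩ := hs g hsucc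
    exact lt_of_le_of_lt (CobordantGame.leastRank_le hWg) hβ

end Summit.ResolutionOfSingularities.ResolutionOfSingularities.Theorems
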